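import Mathlib
import Summits.Ventures.PercRepro2.Switching

/-!
# The last-vertex lemma (PercRepro2, mine-1)

For a configuration `ω` and two disjoint sets `K`, `L` of open edges (witnesses of `s ↔ a` and
`s ↔ b`), an open `s–t` path has a *last* vertex on the `s`-components of `K` and `L`; after it the
path uses neither component.  Hence `s ↔ t` survives closing the `s`-component of `L`, or closing
the `s`-component of `K` (`conn_closeOn_or`, MINE-1.md Lemma 14.1).  Consequently

  `{s↔a} ∘ {s↔b} ∩ {s↔t} ⊆ ({s↔a} ∩ {s↔t}) ∘ {s↔b} ∪ {s↔a} ∘ ({s↔b} ∩ {s↔t})`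

(`disjointConnEvent_inter_connEvent_subset`).  `ThreePointConn.lean` draws the probabilistic
consequences (the percolation form of the three-point inequality, and conditional BK for two
edge-disjoint paths to one target).

Ingredients: `closeOn ω L` (the configuration with the edges of `L` closed), `sComp ends K s`
(the `s`-component of an edge set), `openSet ω` (the set of open edges).
-/

namespace Summit.Ventures.PercRepro2

/-! ## Closing edges; the `s`-component of an edge set -/

section LastVertex

open Classical

variable {V : Type*} {E : Type*} [DecidableEq E]

/-- The configuration `ω` with the edges of `L` closed. -/
def closeOn (ω : Config E) (L : Finset E) : Config E := fun e => ω e && !(decide (e ∈ L))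

/-- Closing edges only decreases the configuration. -/
lemma closeOn_le (ω : Config E) (L : Finset E) : closeOn ω L ≤ ω := by
  intro e
  simp only [closeOn]
  cases ω e <;> simp

/-- Outside `L`, `closeOn ω L` agrees with `ω`. -/
lemma closeOn_apply_of_not_mem {ω : Config E} {L : Finset E} {e : E} (he : e ∉ L) :
    closeOn ω L e = ω e := by
  simp [closeOn, he]

/-- Closing more edges gives a smaller configuration. -/
lemma closeOn_anti {ω : Config E} {L L' : Finset E} (h : L ⊆ L') :
    closeOn ω L' ≤ closeOn ω L := by
  intro e
  simp only [closeOn]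
  by_cases he : e ∈ L
  · simp [he, h he]
  · by_cases he' : e ∈ L'
    · simp [he']
    · simp [he, he']

/-- A set of open edges disjoint from `L` is still open in `closeOn ω L`. -/
lemma ofFinset_le_closeOn {ω : Config E} {K L : Finset E} (hK : ∀ e ∈ K, ω e = true)
    (hKL : Disjoint K L) : ofFinset K ≤ closeOn ω L := by
  intro e
  by_cases he : e ∈ K
  · have h1 : ω e = true := hK e he
    have h2 : e ∉ L := Finset.disjoint_left.1 hKL he
    simp [ofFinset, closeOn, he, h1, h2]
  · simp [ofFinset, he]

/-- The `s`-component of an edge set `K`: the edges of `K` with an endpoint reachable from `s`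
inside `K`. -/
noncomputable def sComp (ends : E → Sym2 V) (K : Finset E) (s : V) : Finset E :=
  K.filter (fun e => ∃ x ∈ ends e, Carries ends K s x)

/-- The `s`-component is a subset of `K`. -/
lemma sComp_subset (ends : E → Sym2 V) (K : Finset E) (s : V) : sComp ends K s ⊆ K :=
  Finset.filter_subset _ _

/-- Both endpoints of an edge of the `s`-component of `K` are reachable from `s` in `K`. -/
lemma carries_of_mem_sComp {ends : E → Sym2 V} {K : Finset E} {s : V} {e : E}
    (he : e ∈ sComp ends K s) {x : V} (hx : x ∈ ends e) : Carries ends K s x := by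
  rw [sComp, Finset.mem_filter] at he
  obtain ⟨heK, y, hy, hsy⟩ := he
  by_cases hxy : y = x
  · subst hxy; exact hsy
  · have hends : ends e = s(y, x) := (Sym2.mem_and_mem_iff hxy).1 ⟨hy, hx⟩
    have hadj : OpenAdj ends (ofFinset K) y x := ⟨e, ofFinset_eq_true_iff.2 heK, hends⟩
    exact conn_trans hsy (conn_of_openAdj hadj)

/-- The `s`-component of `K` carries every path from `s` that `K` carries. -/
lemma carries_sComp {ends : E → Sym2 V} {K : Finset E} {s a : V} (h : Carries ends K s a) :
    Carries ends (sComp ends K s) s a := by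
  refine mem_of_conn_of_closed (ends := ends) (ω := ofFinset K)
    (S := {y | Carries ends (sComp ends K s) s y}) ?_ (conn_refl _ _ _) h
  intro x hx y hxy
  rw [openGraph_adj] at hxy
  obtain ⟨_, e, he, hends⟩ := hxy
  rw [ofFinset_eq_true_iff] at he
  have hx' : Carries ends K s x := Carries.mono (sComp_subset ends K s) hx
  have heS : e ∈ sComp ends K s := by
    rw [sComp, Finset.mem_filter]
    exact ⟨he, x, by rw [hends]; exact Sym2.mem_mk_left x y, hx'⟩
  have hadj : OpenAdj ends (ofFinset (sComp ends K s)) x y :=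
    ⟨e, ofFinset_eq_true_iff.2 heS, hends⟩
  exact conn_trans hx (conn_of_openAdj hadj)

/-- **Last-vertex lemma** (MINE-1.md Lemma 14.1).  If `K`, `L` are disjoint sets of open edges of
`ω` and `s ↔ t` in `ω`, then `s ↔ t` still holds after closing the `s`-component of `L`, or after
closing the `s`-component of `K`: an open `s–t` path has a last vertex on the two components, and
after it the path avoids both. -/
theorem conn_closeOn_or {ends : E → Sym2 V} {ω : Config E} {K L : Finset E}
    (hKL : Disjoint K L) (hK : ∀ e ∈ K, ω e = true) (hL : ∀ e ∈ L, ω e = true) {s t : V}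
    (hst : Conn ends ω s t) :
    Conn ends (closeOn ω (sComp ends L s)) s t ∨ Conn ends (closeOn ω (sComp ends K s)) s t := by
  have hKsub : sComp ends K s ⊆ sComp ends K s ∪ sComp ends L s := Finset.subset_union_left
  have hLsub : sComp ends L s ⊆ sComp ends K s ∪ sComp ends L s := Finset.subset_union_right
  -- the vertices from which `t` is reached "appropriately" form a set closed under open adjacency
  have hsQ : Conn ends (closeOn ω (sComp ends K s ∪ sComp ends L s)) s t ∨
      (∃ u, Carries ends K s u ∧ Conn ends (closeOn ω (sComp ends L s)) u t) ∨
      (∃ w, Carries ends L s w ∧ Conn ends (closeOn ω (sComp ends K s)) w t) := by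
    refine mem_of_conn_of_closed (ends := ends) (ω := ω)
      (S := {y | Conn ends (closeOn ω (sComp ends K s ∪ sComp ends L s)) y t ∨
        (∃ u, Carries ends K s u ∧ Conn ends (closeOn ω (sComp ends L s)) u t) ∨
        (∃ w, Carries ends L s w ∧ Conn ends (closeOn ω (sComp ends K s)) w t)})
      ?_ ?_ (conn_symm hst)
    · intro x hx y hxy
      rw [openGraph_adj] at hxy
      obtain ⟨_, e, he, hends⟩ := hxy
      rcases hx with hx | hx | hx
      · by_cases heK : e ∈ sComp ends K s
        · refine Or.inr (Or.inl ⟨x, carries_of_mem_sComp heK ?_, ?_⟩)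
          · rw [hends]; exact Sym2.mem_mk_left x y
          · exact conn_mono (closeOn_anti hLsub) hx
        · by_cases heL : e ∈ sComp ends L s
          · refine Or.inr (Or.inr ⟨x, carries_of_mem_sComp heL ?_, ?_⟩)
            · rw [hends]; exact Sym2.mem_mk_left x y
            · exact conn_mono (closeOn_anti hKsub) hx
          · refine Or.inl ?_
            have hnot : e ∉ sComp ends K s ∪ sComp ends L s := by
              rw [Finset.mem_union]; exact fun h => h.elim heK heL
            have hadj : OpenAdj ends (closeOn ω (sComp ends K s ∪ sComp ends L s)) y x :=
              ⟨e, by rw [closeOn_apply_of_not_mem hnot, he], by rw [hends, Sym2.eq_swap]⟩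
            exact conn_trans (conn_of_openAdj hadj) hx
      · exact Or.inr (Or.inl hx)
      · exact Or.inr (Or.inr hx)
    · exact Or.inl (conn_refl _ _ _)
  rcases hsQ with h | ⟨u, hu, hut⟩ | ⟨w, hw, hwt⟩
  · exact Or.inl (conn_mono (closeOn_anti hLsub) h)
  · refine Or.inl (conn_trans ?_ hut)
    exact conn_mono (ofFinset_le_closeOn hK (hKL.mono_right (sComp_subset ends L s))) hu
  · refine Or.inr (conn_trans ?_ hwt)
    exact conn_mono (ofFinset_le_closeOn hL (hKL.symm.mono_right (sComp_subset ends K s))) hw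

end LastVertex

/-! ## The union decomposition of `{s↔a} ∘ {s↔b} ∩ {s↔t}` -/

section Decomposition

variable {V : Type*} {E : Type*} [Fintype E] [DecidableEq E]

/-- The set of open edges of `ω`. -/
def openSet (ω : Config E) : Finset E := Finset.univ.filter (fun e => ω e = true)

/-- `ofFinset` of the open set is the configuration itself. -/
lemma ofFinset_openSet (ω : Config E) : ofFinset (openSet ω) = ω := by
  funext e
  simp [ofFinset, openSet]

/-- The open set of `ofFinset S` is `S`. -/
lemma openSet_ofFinset (S : Finset E) : openSet (ofFinset S) = S := by
  ext e
  simp [openSet, ofFinset]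

omit [DecidableEq E] in
/-- Every edge of the open set is open. -/
lemma mem_openSet {ω : Config E} {e : E} : e ∈ openSet ω ↔ ω e = true := by
  simp [openSet]

/-- `ofFinset (openSet ω \ L) = closeOn ω L`. -/
lemma ofFinset_openSet_sdiff (ω : Config E) (L : Finset E) :
    ofFinset (openSet ω \ L) = closeOn ω L := by
  funext e
  by_cases he : e ∈ L
  · simp [ofFinset, openSet, closeOn, he]
  · simp [ofFinset, openSet, closeOn, he]

/-- **Union decomposition** (MINE-1.md §14.1): an open `s–t` path together with edge-disjoint
witnesses of `s ↔ a` and `s ↔ b` yields edge-disjoint witnesses of `{s↔a} ∩ {s↔t}` and `{s↔b}`,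
or of `{s↔a}` and `{s↔b} ∩ {s↔t}`. -/
theorem disjointConnEvent_inter_connEvent_subset (ends : E → Sym2 V) (s t a b : V) :
    disjointConnEvent ends s a b ∩ connEvent ends s t ⊆
      {ω | ∃ K L : Finset E, Disjoint K L ∧ (∀ e ∈ K, ω e = true) ∧ (∀ e ∈ L, ω e = true) ∧
        Carries ends K s a ∧ Carries ends K s t ∧ Carries ends L s b} ∪
      {ω | ∃ K L : Finset E, Disjoint K L ∧ (∀ e ∈ K, ω e = true) ∧ (∀ e ∈ L, ω e = true) ∧
        Carries ends K s a ∧ Carries ends L s b ∧ Carries ends L s t} := by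
  rintro ω ⟨⟨K, L, hKL, hK, hL, hKa, hLb⟩, hst⟩
  rcases conn_closeOn_or hKL hK hL hst with h | h
  · left
    have hsub : K ⊆ openSet ω \ sComp ends L s := by
      intro e he
      rw [Finset.mem_sdiff, mem_openSet]
      exact ⟨hK e he, fun h' => Finset.disjoint_left.1 hKL he (sComp_subset ends L s h')⟩
    refine ⟨openSet ω \ sComp ends L s, sComp ends L s, Finset.sdiff_disjoint, ?_, ?_, ?_, ?_,
      carries_sComp hLb⟩
    · intro e he
      exact mem_openSet.1 (Finset.mem_sdiff.1 he).1
    · intro e he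
      exact hL e (sComp_subset ends L s he)
    · exact Carries.mono hsub hKa
    · show Conn ends (ofFinset (openSet ω \ sComp ends L s)) s t
      rw [ofFinset_openSet_sdiff]
      exact h
  · right
    have hsub : L ⊆ openSet ω \ sComp ends K s := by
      intro e he
      rw [Finset.mem_sdiff, mem_openSet]
      exact ⟨hL e he, fun h' => Finset.disjoint_right.1 hKL he (sComp_subset ends K s h')⟩
    refine ⟨sComp ends K s, openSet ω \ sComp ends K s, Finset.disjoint_sdiff, ?_, ?_,
      carries_sComp hKa, ?_, ?_⟩
    · intro e he
      exact hK e (sComp_subset ends K s he)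
    · intro e he
      exact mem_openSet.1 (Finset.mem_sdiff.1 he).1
    · exact Carries.mono hsub hLb
    · show Conn ends (ofFinset (openSet ω \ sComp ends K s)) s t
      rw [ofFinset_openSet_sdiff]
      exact h

end Decomposition

end Summit.Ventures.PercRepro2
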